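import Mathlib
import Summits.Ventures.PercRepro2.Defs
import Summits.Ventures.PercRepro2.Independence
import Summits.Ventures.PercRepro2.Harris
import Summits.Ventures.PercRepro2.Graph
import Summits.Ventures.PercRepro2.Exploration
import Summits.Ventures.PercRepro2.Events
import Summits.Ventures.PercRepro2.FourFunctions
import Summits.Ventures.PercRepro2.Induced
import Summits.Ventures.PercRepro2.Frontier
import Summits.Ventures.PercRepro2.ObsIndependence
import Summits.Ventures.PercRepro2.BHK
import Summits.Ventures.PercRepro2.BHKEvents
import Summits.Ventures.PercRepro2.OrderPreservation
import Summits.Ventures.PercRepro2.BHKAvoid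
import Summits.Ventures.PercRepro2.SameClusterAvoid
import Summits.Ventures.PercRepro2.CaseOneRegime
import Summits.Ventures.PercRepro2.CaseOnePos
import Summits.Ventures.PercRepro2.CaseOneJ11
import Summits.Ventures.PercRepro2.CaseOneRV
import Summits.Ventures.PercRepro2.CaseOnePendant
import Summits.Ventures.PercRepro2.CaseOnePendantAny
import Summits.Ventures.PercRepro2.CaseOnePendantNec
import Summits.Ventures.PercRepro2.HullDefs
import Summits.Ventures.PercRepro2.OneEdge
import Summits.Ventures.PercRepro2.HCov
import Summits.Ventures.PercRepro2.HCovSwap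
import Summits.Ventures.PercRepro2.OddsLemma
import Summits.Ventures.PercRepro2.RV
import Summits.Ventures.PercRepro2.RVBridge
import Summits.Ventures.PercRepro2.CaseOneDWorld

/-!
# Pinning an `a₁a₃`-edge in the D-world: the pointwise facts and the mass identities (blind cell
PercRepro2, p1 g14; S5 §2.1 (K9), proofs/P1-DWORLD.md §2, identity (E), part 1)

In the D-world `D = Q ∩ {a₃ ∉ C₂}` an edge `e₁ = {a₁, a₃}` cannot create an `a₁`–`a₂` connection
(that would put `a₃ ∈ C₂`) and does not change `C₂`: `D` and every event `{x ∈ C₂} ∩ D` ignore the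
state of `e₁` (**`mem_Dw_update_iff`**, **`conn_a2_update_true_iff`**), while `{a₃ ∈ C₁}` holds outright
when `e₁` is open (`conn_a1_a3_update_true`). Pinning `e₁` (weight `p₁`; `p₀ := p[e₁ ↦ 0]` is the
instance with `e₁` deleted): `P(X ∩ D)` ignores the weight of `e₁` (**`prob_inter_Dw_update`**), the
`A`-masses split as `P(X ∩ A ∩ D) = p₁ P₀(X ∩ D) + (1 − p₁) P₀(X ∩ A ∩ D)` (**`prob_A_inter_Dw_pin`**),
and the PD pair scales: `D(p) = (1 − p₁) D(p₀)`, `D_o(p) = (1 − p₁) D_o(p₀)` (**`Dpd_a1_edge`**,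
**`Dpdo_a1_edge`**). The identity (E) itself and its consequence for `ZSplitIID` are in
`CaseOneDWorldEdge.lean`. Also the general pinning tools `expect_eq_update_pin`,
`expect_mul_closedEdge_of_ignore`, `eq_update_true_or_false`. Own code; standard axioms.
-/

namespace Summit.Ventures.PercRepro2

namespace CaseOne

/-! ## Pinning one edge -/

section Pin
variable {E : Type*} [Fintype E] [DecidableEq E] {R : Type*} [CommRing R]

/-- The pinning identity with the pinned configurations made explicit. -/
lemma expect_eq_update_pin (p : E → R) (f : Config E → R) (e : E) :
    expect p f = p e * expect p (fun ω => f (Function.update ω e true)) +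
      (1 - p e) * expect p (fun ω => f (Function.update ω e false)) := by
  rw [expect_eq_pin p f e, expect_update_one, expect_update_zero]

/-- `E[f · 1[e closed]] = (1 − p(e)) · E[f]` when `f` ignores the edge `e`. -/
lemma expect_mul_closedEdge_of_ignore (p : E → R) (e : E) (f : Config E → R)
    (hf : ∀ ω c, f (Function.update ω e c) = f ω) :
    expect p (fun ω => f ω * (closedEdge e).indicator 1 ω) = (1 - p e) * expect p f := by
  have h : (fun ω => f ω * (closedEdge e).indicator (1 : Config E → R) ω) =
      (fun ω => f ω) - (fun ω => f ω * (openEdge e).indicator 1 ω) := by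
    funext ω
    rw [closedEdge_eq_compl, Set.indicator_compl]
    simp only [Pi.sub_apply, Pi.one_apply]
    ring
  rw [h, expect_sub, expect_mul_openEdge_of_ignore p e f hf]
  ring

omit [Fintype E] in
/-- A configuration is one of its two pinned versions. -/
lemma eq_update_true_or_false (ω : Config E) (e : E) :
    ω = Function.update ω e true ∨ ω = Function.update ω e false := by
  by_cases h : ω e = true
  · left; rw [← h, Function.update_eq_self]
  · right
    have h' : ω e = false := by simpa using h
    rw [← h', Function.update_eq_self]

end Pin

/-! ## The pointwise facts: `D` ignores an `a₁a₃`-edge -/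

section Pointwise
variable {V : Type*} {E : Type*} [DecidableEq E] {ends : E → Sym2 V} {a₁ a₂ a₃ : V} {e₁ : E}

/-- With `e₁ = {a₁, a₃}`: the configuration with `e₁` open is in `D` iff the one with `e₁` closed is. -/
lemma mem_Dw_update_iff (he : ends e₁ = s(a₁, a₃)) (ω : Config E) :
    Function.update ω e₁ true ∈ Dw ends a₁ a₂ a₃ ↔
      Function.update ω e₁ false ∈ Dw ends a₁ a₂ a₃ := by
  set ω₀ := Function.update ω e₁ false with hω₀
  have hω₁ : Function.update ω e₁ true = Function.update ω₀ e₁ true := by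
    rw [hω₀, Function.update_idem]
  rw [hω₁]
  simp only [Dw, Set.mem_inter_iff, Set.mem_compl_iff, mem_connEvent]
  rw [OneEdge.conn_update_true_iff he ω₀ a₁ a₂, OneEdge.conn_update_true_iff he ω₀ a₂ a₃]
  constructor
  · rintro ⟨h1, h2⟩
    exact ⟨fun h => h1 (Or.inl h), fun h => h2 (Or.inl h)⟩
  · rintro ⟨h1, h2⟩
    refine ⟨?_, ?_⟩
    · rintro (h | ⟨_, h⟩ | ⟨_, h⟩)
      · exact h1 h
      · exact h2 (conn_symm h)
      · exact h1 h
    · rintro (h | ⟨h, _⟩ | ⟨h, _⟩)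
      · exact h2 h
      · exact h1 (conn_symm h)
      · exact h2 h

/-- On `D` (with `e₁` closed), opening `e₁ = {a₁, a₃}` changes no `a₂`-connection. -/
lemma conn_a2_update_true_iff (he : ends e₁ = s(a₁, a₃)) {ω₀ : Config E}
    (hD : ω₀ ∈ Dw ends a₁ a₂ a₃) (y : V) :
    Conn ends (Function.update ω₀ e₁ true) a₂ y ↔ Conn ends ω₀ a₂ y := by
  obtain ⟨h1, h2⟩ := hD
  simp only [Set.mem_compl_iff, mem_connEvent] at h1 h2
  rw [OneEdge.conn_update_true_iff he ω₀ a₂ y]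
  constructor
  · rintro (h | ⟨h, _⟩ | ⟨h, _⟩)
    · exact h
    · exact absurd (conn_symm h) h1
    · exact absurd h h2
  · exact fun h => Or.inl h

/-- With `e₁ = {a₁, a₃}` open, `a₃ ∈ C₁`. -/
lemma conn_a1_a3_update_true (he : ends e₁ = s(a₁, a₃)) (ω : Config E) :
    Conn ends (Function.update ω e₁ true) a₁ a₃ :=
  conn_of_openAdj ⟨e₁, by simp, he⟩

omit [DecidableEq E] in
/-- `{a₃ ∉ U} ∩ Q` (the PD event) forces `e₁ = {a₁, a₃}` closed. -/
lemma update_false_of_mem_PD (he : ends e₁ = s(a₁, a₃)) {ω : Config E}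
    (h : ω ∈ (connEvent ends a₁ a₃)ᶜ ∩ (connEvent ends a₂ a₃)ᶜ ∩ (connEvent ends a₁ a₂)ᶜ) :
    ω e₁ = false := by
  by_contra hc
  have hc' : ω e₁ = true := by simpa using hc
  exact h.1.1 (conn_of_openAdj ⟨e₁, hc', he⟩)

end Pointwise

/-! ## The mass identities under the pinning of an `a₁a₃`-edge -/

section Masses
variable {V : Type*} {E : Type*} [Fintype E] [DecidableEq E] {R : Type*} [CommRing R]
variable {ends : E → Sym2 V} {a₁ a₂ a₃ : V} {e₁ : E}

omit [Fintype E] in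
/-- Membership in `X ∩ D` for an `a₂`-connection event `X` ignores `e₁`. -/
lemma mem_inter_Dw_update_iff (he : ends e₁ = s(a₁, a₃)) (X : Set (Config E))
    (hX : ∀ ω₀ ∈ Dw ends a₁ a₂ a₃, Function.update ω₀ e₁ true ∈ X ↔ ω₀ ∈ X) (ω : Config E) :
    Function.update ω e₁ true ∈ X ∩ Dw ends a₁ a₂ a₃ ↔
      Function.update ω e₁ false ∈ X ∩ Dw ends a₁ a₂ a₃ := by
  set ω₀ := Function.update ω e₁ false with hω₀
  have hω₁ : Function.update ω e₁ true = Function.update ω₀ e₁ true := by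
    rw [hω₀, Function.update_idem]
  rw [hω₁]
  have hD : Function.update ω₀ e₁ true ∈ Dw ends a₁ a₂ a₃ ↔ ω₀ ∈ Dw ends a₁ a₂ a₃ := by
    have := mem_Dw_update_iff (a₂ := a₂) he ω
    rw [hω₁] at this
    exact this
  constructor
  · rintro ⟨hx, hd⟩
    have hd' := hD.1 hd
    exact ⟨(hX ω₀ hd').1 hx, hd'⟩
  · rintro ⟨hx, hd⟩
    exact ⟨(hX ω₀ hd).2 hx, hD.2 hd⟩

omit [Fintype E] in
/-- The indicator of `X ∩ D` ignores `e₁` (for an `a₂`-connection event `X`). -/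
lemma indicator_inter_Dw_update (he : ends e₁ = s(a₁, a₃)) (X : Set (Config E))
    (hX : ∀ ω₀ ∈ Dw ends a₁ a₂ a₃, Function.update ω₀ e₁ true ∈ X ↔ ω₀ ∈ X) (ω : Config E)
    (c : Bool) :
    (X ∩ Dw ends a₁ a₂ a₃).indicator (1 : Config E → R) (Function.update ω e₁ c) =
      (X ∩ Dw ends a₁ a₂ a₃).indicator 1 ω := by
  have key : ∀ ω' : Config E, (X ∩ Dw ends a₁ a₂ a₃).indicator (1 : Config E → R) ω' =
      (X ∩ Dw ends a₁ a₂ a₃).indicator 1 (Function.update ω' e₁ false) := by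
    intro ω'
    rcases eq_update_true_or_false ω' e₁ with h | h
    · rw [h, Function.update_idem]
      by_cases hm : Function.update ω' e₁ false ∈ X ∩ Dw ends a₁ a₂ a₃
      · simp only [Set.indicator_of_mem ((mem_inter_Dw_update_iff he X hX ω').2 hm),
          Set.indicator_of_mem hm, Pi.one_apply]
      · rw [Set.indicator_of_notMem (fun h' => hm ((mem_inter_Dw_update_iff he X hX ω').1 h')),
          Set.indicator_of_notMem hm]
    · rw [← h]
  rw [key, key ω, Function.update_idem]

/-- `P(X ∩ D)` does not depend on the weight of `e₁`. -/
lemma prob_inter_Dw_update (p : E → R) (he : ends e₁ = s(a₁, a₃)) (X : Set (Config E))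
    (hX : ∀ ω₀ ∈ Dw ends a₁ a₂ a₃, Function.update ω₀ e₁ true ∈ X ↔ ω₀ ∈ X) (t : R) :
    prob (Function.update p e₁ t) (X ∩ Dw ends a₁ a₂ a₃) = prob p (X ∩ Dw ends a₁ a₂ a₃) :=
  prob_update_of_ignore p e₁ t _ (indicator_inter_Dw_update he X hX)

/-- **The `A`-masses under the pinning**: `P(X ∩ A ∩ D) = p₁ P₀(X ∩ D) + (1 − p₁) P₀(X ∩ A ∩ D)`. -/
lemma prob_A_inter_Dw_pin (p : E → R) (he : ends e₁ = s(a₁, a₃)) (X : Set (Config E))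
    (hX : ∀ ω₀ ∈ Dw ends a₁ a₂ a₃, Function.update ω₀ e₁ true ∈ X ↔ ω₀ ∈ X) :
    prob p (X ∩ connEvent ends a₁ a₃ ∩ Dw ends a₁ a₂ a₃) =
      p e₁ * prob (Function.update p e₁ 0) (X ∩ Dw ends a₁ a₂ a₃) +
        (1 - p e₁) * prob (Function.update p e₁ 0) (X ∩ connEvent ends a₁ a₃ ∩ Dw ends a₁ a₂ a₃) := by
  rw [prob_eq_expect_indicator, expect_eq_update_pin p _ e₁, prob_eq_expect_indicator,
    prob_eq_expect_indicator, expect_update_zero, expect_update_zero]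
  -- with `e₁` open: `a₃ ∈ C₁` holds and `X ∩ D` is read off the closed version
  have key : (fun ω : Config E => (X ∩ connEvent ends a₁ a₃ ∩ Dw ends a₁ a₂ a₃).indicator
      (1 : Config E → R) (Function.update ω e₁ true)) =
      fun ω => (X ∩ Dw ends a₁ a₂ a₃).indicator 1 (Function.update ω e₁ false) := by
    funext ω
    by_cases hm : Function.update ω e₁ false ∈ X ∩ Dw ends a₁ a₂ a₃
    · have hm' : Function.update ω e₁ true ∈ X ∩ connEvent ends a₁ a₃ ∩ Dw ends a₁ a₂ a₃ := by
        have h1 := (mem_inter_Dw_update_iff he X hX ω).2 hm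
        exact ⟨⟨h1.1, conn_a1_a3_update_true he ω⟩, h1.2⟩
      simp only [Set.indicator_of_mem hm', Set.indicator_of_mem hm, Pi.one_apply]
    · have hm' : Function.update ω e₁ true ∉ X ∩ connEvent ends a₁ a₃ ∩ Dw ends a₁ a₂ a₃ := by
        intro h
        exact hm ((mem_inter_Dw_update_iff he X hX ω).1 ⟨h.1.1, h.2⟩)
      rw [Set.indicator_of_notMem hm', Set.indicator_of_notMem hm]
  rw [key]

omit [Fintype E] in
/-- The `a₂`-connection events and their intersections qualify for the pinning lemmas. -/
lemma a2_event_update (he : ends e₁ = s(a₁, a₃)) (y : V) :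
    ∀ ω₀ ∈ Dw ends a₁ a₂ a₃, Function.update ω₀ e₁ true ∈ connEvent ends a₂ y ↔
      ω₀ ∈ connEvent ends a₂ y :=
  fun ω₀ hD => by simp only [mem_connEvent]; exact conn_a2_update_true_iff he hD y

omit [Fintype E] in
/-- Intersections of qualifying events qualify. -/
lemma inter_event_update {X Y : Set (Config E)}
    (hX : ∀ ω₀ ∈ Dw ends a₁ a₂ a₃, Function.update ω₀ e₁ true ∈ X ↔ ω₀ ∈ X)
    (hY : ∀ ω₀ ∈ Dw ends a₁ a₂ a₃, Function.update ω₀ e₁ true ∈ Y ↔ ω₀ ∈ Y) :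
    ∀ ω₀ ∈ Dw ends a₁ a₂ a₃, Function.update ω₀ e₁ true ∈ X ∩ Y ↔ ω₀ ∈ X ∩ Y :=
  fun ω₀ hD => by
    simp only [Set.mem_inter_iff]
    rw [hX ω₀ hD, hY ω₀ hD]

omit [Fintype E] in
/-- The sure event qualifies. -/
lemma univ_event_update :
    ∀ ω₀ ∈ Dw ends a₁ a₂ a₃, Function.update ω₀ e₁ true ∈ (Set.univ : Set (Config E)) ↔
      ω₀ ∈ (Set.univ : Set (Config E)) :=
  fun _ _ => by simp

/-- **The PD mass under the pinning**: `D(p) = (1 − p₁) D(p₀)`. -/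
theorem Dpd_a1_edge (p : E → R) (he : ends e₁ = s(a₁, a₃)) :
    Dpd p ends a₁ a₂ a₃ = (1 - p e₁) * Dpd (Function.update p e₁ 0) ends a₁ a₂ a₃ := by
  unfold Dpd
  rw [prob_eq_expect_indicator, expect_eq_update_pin p _ e₁, prob_eq_expect_indicator,
    expect_update_zero]
  have h1 : expect p (fun ω => ((connEvent ends a₁ a₃)ᶜ ∩ (connEvent ends a₂ a₃)ᶜ ∩
      (connEvent ends a₁ a₂)ᶜ).indicator (1 : Config E → R) (Function.update ω e₁ true)) = 0 := by
    unfold expect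
    refine Finset.sum_eq_zero fun ω _ => ?_
    dsimp only
    rw [Set.indicator_of_notMem]
    · ring
    · intro h
      have := update_false_of_mem_PD he h
      simp at this
  rw [h1]
  ring

/-- **The `PD ∩ {o ∈ U}` mass under the pinning**: `D_o(p) = (1 − p₁) D_o(p₀)`. -/
theorem Dpdo_a1_edge (p : E → R) (he : ends e₁ = s(a₁, a₃)) (o : V) :
    Dpdo p ends o a₁ a₂ a₃ = (1 - p e₁) * Dpdo (Function.update p e₁ 0) ends o a₁ a₂ a₃ := by
  unfold Dpdo
  rw [prob_eq_expect_indicator, expect_eq_update_pin p _ e₁, prob_eq_expect_indicator,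
    expect_update_zero]
  have h1 : expect p (fun ω => ((connEvent ends a₁ o ∪ connEvent ends a₂ o) ∩
      (connEvent ends a₁ a₃)ᶜ ∩ (connEvent ends a₂ a₃)ᶜ ∩
      (connEvent ends a₁ a₂)ᶜ).indicator (1 : Config E → R) (Function.update ω e₁ true)) = 0 := by
    unfold expect
    refine Finset.sum_eq_zero fun ω _ => ?_
    dsimp only
    rw [Set.indicator_of_notMem]
    · ring
    · intro h
      have := update_false_of_mem_PD he ⟨⟨h.1.1.2, h.1.2⟩, h.2⟩
      simp at this
  rw [h1]
  ring

end Masses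

end CaseOne

end Summit.Ventures.PercRepro2
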